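import Mathlib
import Summits.ValiantsHypothesis.ValiantsHypothesis.Theorems.FifoMatchingNNNotVPCliqueProgramRun
import HarnessLib

/-!
# Route FifoMatching — crux `NNNotVP` (stmt-ValiantsHypothesis-11615), line `division_split`:
# the clique token program REJECTS every colouring vector

Companion of `…CliqueProgramDefs` / `…Basics` / `…Run`.

* `cliqueLab_noRun_colorVec` — for `k ≥ 1`, `R + 4 = 5k` and a colouring `O : Fin m → Fin (k-1)`,
  the clique program `cliqueLab` (initial labels `lab0`) has NO run on `colorVec O`
  (non-crossing position maps with all met labels on): by `run_macroRound` the guessed vertices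
  `a i` persist and after `r` macro-rounds the travelling register of token `i` is `a (i-r)`
  (blank for `i < r`); the CHECK of macro-round `r` at token `i ≥ r` forces
  `O (a i) ≠ O (a (i-r))`, so `O ∘ a : Fin k → Fin (k-1)` would be injective — pigeonhole.

Honest framing: one half of "the clique program is a clique-like projection"; stub A follows in
the assembly companion; the crux `NNNotVP` and `VP ≠ VNP` stay OPEN (NOT proved).  No
definitions, no named facts.
-/

noncomputable section

-- Sub = Summit single-conjunct layout: the duplicated namespace component is mandated by the tree.
set_option linter.dupNamespace false

namespace Summit.ValiantsHypothesis.ValiantsHypothesis.Theorems.FifoMatching.NNNotVP.DivisionSplit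

open Literature.Computability.Complexity
open scoped Classical

/-! ### REJECT: the clique program has no run on a colouring vector -/

section Reject

variable {k m : ℕ}

/-- The colouring vector on an edge `{u, v}` is on iff the colours differ. [folklore] -/
theorem colorVec_mk_eq_true_iff {c : ℕ} (O : Fin m → Fin c) (u v : Fin m)
    (h : s(u, v) ∈ (⊤ : SimpleGraph (Fin m)).edgeSet) :
    colorVec O ⟨s(u, v), h⟩ = true ↔ O u ≠ O v := by
  simp [colorVec, Sym2.mk_isDiag_iff]

/-- **REJECT.**  On the colouring vector of any `O : Fin m → Fin (k-1)` the clique program with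
`k ≥ 1` tokens and `R = 5k - 4` rounds has NO run: along a run the guessed vertices `a i` keep
their registers, the travelling register after `r` macro-rounds is `a (i-r)` (blank for `i < r`)
by `run_macroRound`, and the CHECK of macro-round `r` forces `O (a i) ≠ O (a (i-r))`; over all
`r` the map `O ∘ a : Fin k → Fin (k-1)` would be injective. [folklore] -/
theorem cliqueLab_noRun_colorVec (hk : 1 ≤ k) {R : ℕ} (hR : R + 4 = 5 * k) {c : ℕ}
    (hc : c + 1 = k) (O : Fin m → Fin c) (P : Fin R → Fin k → Pos k m)
    (hP : ∀ j, StrictMono (P j))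
    (h0 : ∀ i, Sum.elim (colorVec O) id (lab0 i (P ⟨0, by omega⟩ i)) = true)
    (hS : ∀ (j : Fin R) (h : j.val + 1 < R) (i : Fin k),
      Sum.elim (colorVec O) id (cliqueLab j (P j i) (P ⟨j.val + 1, h⟩ i)) = true) : False := by
  -- the guessed vertices
  have hguess : ∀ i, ∃ a : Fin m,
      P ⟨0, by omega⟩ i = home i (mkRegs a (Fin.castSucc a) (Fin.last m)) :=
    fun i => (lab0_on_iff (colorVec O) i _).1 (h0 i)
  choose a ha using hguess
  -- the travelling register after `r` macro-rounds
  let B : ℕ → Fin k → Fin (m + 1) := fun r i =>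
    if h : i.val < r then Fin.last m else Fin.castSucc (a ⟨i.val - r, by omega⟩)
  have main : ∀ (r : ℕ) (hr : r + 1 ≤ k),
      (∀ i, ∃ c', P ⟨5 * r, by omega⟩ i = home i (mkRegs (a i) (B r i) c')) ∧
      (∀ r' : ℕ, 1 ≤ r' → r' ≤ r → ∀ (i : Fin k) (hi : r' ≤ i.val),
        O (a i) ≠ O (a ⟨i.val - r', by omega⟩)) := by
    intro r
    induction r with
    | zero =>
      intro _
      refine ⟨fun i => ⟨Fin.last m, ?_⟩, fun r' h1 h2 => by omega⟩
      have hB : B 0 i = Fin.castSucc (a i) := by simp [B]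
      rw [hB]
      exact ha i
    | succ r ih =>
      intro hr
      obtain ⟨ihome, icheck⟩ := ih (by omega)
      have hj5 : 5 * r + 5 < R := by omega
      obtain ⟨hzero, hpos⟩ := run_macroRound (colorVec O) P hP hS a (B r) ⟨5 * r, by omega⟩
        (by dsimp only; omega) hj5 ihome
      have hBsucc : ∀ i : Fin k, 0 < i.val → B (r + 1) i = B r ⟨i.val - 1, by omega⟩ := by
        intro i hi
        simp only [B]
        by_cases h : i.val < r + 1
        · rw [dif_pos h, dif_pos (by omega)]
        · rw [dif_neg h, dif_neg (by omega)]
          exact congrArg (fun t => Fin.castSucc (a t)) (Fin.ext (by dsimp only; omega))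
      have e5 : (⟨5 * (r + 1), by omega⟩ : Fin R) = ⟨5 * r + 5, hj5⟩ :=
        Fin.ext (by dsimp only; omega)
      refine ⟨fun i => ?_, fun r' h1 h2 i hi => ?_⟩
      · rw [e5]
        rcases Nat.eq_zero_or_pos i.val with hi | hi
        · refine ⟨Fin.last m, ?_⟩
          rw [hzero i hi]
          have : B (r + 1) i = Fin.last m := by
            simp only [B]; rw [dif_pos (by omega)]
          rw [this]
        · exact ⟨B r ⟨i.val - 1, by omega⟩, by rw [(hpos i hi).1, hBsucc i hi]⟩
      · rcases Nat.lt_or_ge r' (r + 1) with hlt | hge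
        · exact icheck r' h1 (by omega) i hi
        · have hr' : r' = r + 1 := by omega
          subst hr'
          have hi0 : 0 < i.val := by omega
          have hchk := (hpos i hi0).2
          have hB' : B r ⟨i.val - 1, by omega⟩ =
              Fin.castSucc (a ⟨i.val - (r + 1), by omega⟩) := by
            simp only [B]
            rw [dif_neg (by omega)]
            exact congrArg (fun t => Fin.castSucc (a t)) (Fin.ext (by dsimp only; omega))
          rw [hB', elim_chk_castSucc_iff] at hchk
          obtain ⟨hne, hcol⟩ := hchk
          exact (colorVec_mk_eq_true_iff O _ _ _).1 hcol
  -- pigeonhole: `O ∘ a` would be injective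
  obtain ⟨-, hcheck⟩ := main (k - 1) (by omega)
  have hinj : Function.Injective (fun i => O (a i)) := by
    intro i i' h
    by_contra hne
    rcases lt_or_gt_of_ne hne with hlt | hlt
    · have hv : i.val < i'.val := hlt
      have hi' := i'.isLt
      have := hcheck (i'.val - i.val) (by omega) (by omega) i' (by omega)
      have e : (⟨i'.val - (i'.val - i.val), by omega⟩ : Fin k) = i := Fin.ext (by dsimp only; omega)
      rw [e] at this
      exact this h.symm
    · have hv : i'.val < i.val := hlt
      have hi' := i.isLt
      have := hcheck (i.val - i'.val) (by omega) (by omega) i (by omega)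
      have e : (⟨i.val - (i.val - i'.val), by omega⟩ : Fin k) = i' := Fin.ext (by dsimp only; omega)
      rw [e] at this
      exact this h
  have := Fintype.card_le_of_injective _ hinj
  simp only [Fintype.card_fin] at this
  omega

end Reject

end Summit.ValiantsHypothesis.ValiantsHypothesis.Theorems.FifoMatching.NNNotVP.DivisionSplit

end
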